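import Summits.QuantumAdvantage.QuantumAdvantage.Theorems.CubicForrelationNearExactIsExactCubicFormR2PartnerLevelTables
import Summits.QuantumAdvantage.QuantumAdvantage.Theorems.CubicForrelationNearExactIsExactCubicFormLightStructure
import Summits.QuantumAdvantage.QuantumAdvantage.Theorems.CubicForrelationNearExactIsExactCubicFormLightRows
import Summits.QuantumAdvantage.QuantumAdvantage.Theorems.CubicForrelationNearExactIsExactTwelvePartnerR2LeafW6

/-!
# Crux `CubicForrelation.NearExactIsExact` (stmt-QuantumAdvantage-14043) — E1280-even, R2 branch: LEVEL `h = 3` (descendant `s₀ω₆`,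
  light cell of weight `112`) END-TO-END

Certificate seat `b2b-cforr-cert` (gen 42).  HONEST FRAMING: kernel-checked assembly (standard axioms) of the `s₀ω₆` endgame of R2-PARTNER §4
/ E1280-HANDPROOFS §1.4 (dual bases in `𝔽₂²`): as …CubicFormR2LevelFour with `h = 3` — every cell weighs `≥ 112` (`tl2_cell_eight_lb`), so
both neighbours weigh `< 160`; `tls_light_structure` gives `G|_H = ε·ω₆`, `Γ|_H = ε'·ω₆`; the two leftover coordinates `F′ = {7, 8}` carry no
monomial of `t̄` (`htbF`); the leaf is `tpa_R2_w6`.  It proves the `(i,j) = (0,0)`, `h = 3` instance of `HL`.  NOT summit progress.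

* `tpw_R2_level_three`.

References: this seat lineage (g37 R2-PARTNER §4 (ω₆), g39 HANDPROOFS §1.4 + leaf `tpa_R2_w6`, g41 cell lemmas).  Axioms: the standard three.
-/

set_option linter.dupNamespace false -- D-0017: single-problem summit ⇒ `QuantumAdvantage.QuantumAdvantage` by design

namespace Summit.QuantumAdvantage.QuantumAdvantage.Theorems.CubicForrelation.NearExactIsExact

open Finset
open Literature.Computability.QuantumComplexity
open Literature.Computability.QuantumComplexity.BuzetChailloux (bxor zeroVec bxor_comm bxor_self bxor_zeroVec zeroVec_bxor
  bxor_bxor_cancel_left)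

/-- **Level `h = 3` (`s₀ω₆`) of the R2 branch, light cell `C₀₀`.**  See the module docstring. [this work] -/
theorem tpw_R2_level_three :
    ∀ (hk : 1 + 3 + 3 ≤ 9), 1 ≤ 3 →
    ∀ (κ : (Fin (3 + 9) → Bool) → Bool), IsDegLeFun 3 κ →
    ∀ (c d : Fin (3 + 9) → Fin (3 + 9) → Fin (3 + 9) → ZMod 2),
    (∀ p j k, c p k j = c p j k) → (∀ p j k, c j p k = c p j k) → (∀ p j, c p j j = 0) →
    (∀ φ j k, d φ k j = d φ j k) → (∀ φ j k, d j φ k = d φ j k) → (∀ φ j, d φ j j = 0) →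
    (∀ φ j k, d φ j k =
      if ((((κ zeroVec ^^ κ (bxor zeroVec (fun l => decide (l = k)))) ^^
              (κ (bxor zeroVec (fun l => decide (l = j))) ^^ κ (bxor (bxor zeroVec (fun l => decide (l = j))) (fun l => decide (l = k))))) ^^
            ((κ (bxor zeroVec (fun l => decide (l = φ))) ^^ κ (bxor (bxor zeroVec (fun l => decide (l = φ))) (fun l => decide (l = k)))) ^^
              (κ (bxor (bxor zeroVec (fun l => decide (l = φ))) (fun l => decide (l = j))) ^^
                κ (bxor (bxor (bxor zeroVec (fun l => decide (l = φ))) (fun l => decide (l = j))) (fun l => decide (l = k))))))) = true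
      then 1 else 0) →
    (∀ p φ, (∑ j, ∑ k, (if j < k then c p j k * d φ j k else 0)) = if p = φ then 1 else 0) →
    (∀ y, (κ y ^^ κ (bxor y (fun l => decide (l = Fin.castAdd 9 (0 : Fin 3))))) =
      (y (Fin.castAdd 9 (1 : Fin 3)) && y (Fin.castAdd 9 (2 : Fin 3)))) →
    (∀ j k, d (Fin.castAdd 9 0) j k =
      if (j = Fin.castAdd 9 1 ∧ k = Fin.castAdd 9 2) ∨ (j = Fin.castAdd 9 2 ∧ k = Fin.castAdd 9 1) then 1 else 0) →
    #(univ.filter fun s : Fin 9 → Bool => κ (Fin.append ![false, false, false] s) = true) +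
      #(univ.filter fun s : Fin 9 → Bool => κ (Fin.append ![false, false, true] s) = true) +
      #(univ.filter fun s : Fin 9 → Bool => κ (Fin.append ![false, true, false] s) = true) < 384 →
    ∀ (i j : Bool), (i && j) = false →
    (∀ i' j' : Bool, (i' && j') = false →
      #(univ.filter fun s : Fin 9 → Bool => κ (Fin.append ![false, i, j] s) = true) ≤
        #(univ.filter fun s : Fin 9 → Bool => κ (Fin.append ![false, i', j'] s) = true)) →
    0 < #(univ.filter fun s : Fin 9 → Bool => κ (Fin.append ![false, i, j] s) = true) →
    4 * #(univ.filter fun s : Fin 9 → Bool => κ (Fin.append ![false, i, j] s) = true) + 2 ^ (9 - 3) = 2 ^ 9 →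
    ∀ (bz : Bool), (∀ s : Fin 9 → Bool, κ (Fin.append ![false, i, j] s) = true → s (Fin.castLE hk (Fin.castAdd 3 (Fin.castAdd 3 (0 : Fin 1)))) = bz) →
    (∀ u v w x : Fin 9 → Bool,
      ((((κ (Fin.append ![false, i, j] x) ^^ κ (Fin.append ![false, i, j] (bxor x w))) ^^
              (κ (Fin.append ![false, i, j] (bxor x v)) ^^ κ (Fin.append ![false, i, j] (bxor (bxor x v) w)))) ^^
            ((κ (Fin.append ![false, i, j] (bxor x u)) ^^ κ (Fin.append ![false, i, j] (bxor (bxor x u) w))) ^^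
              (κ (Fin.append ![false, i, j] (bxor (bxor x u) v)) ^^
                κ (Fin.append ![false, i, j] (bxor (bxor (bxor x u) v) w)))))) =
      ((((u (Fin.castLE hk (Fin.castAdd 3 (Fin.castAdd 3 (0 : Fin 1)))) &&
            decide ((∑ ii : Fin 3, ((if v (Fin.castLE hk (Fin.castAdd 3 (Fin.natAdd 1 ii))) = true then (1 : ZMod 2) else 0) * (if w (Fin.castLE hk (Fin.natAdd (1 + 3) ii)) = true then (1 : ZMod 2) else 0) +
              (if v (Fin.castLE hk (Fin.natAdd (1 + 3) ii)) = true then (1 : ZMod 2) else 0) * (if w (Fin.castLE hk (Fin.castAdd 3 (Fin.natAdd 1 ii))) = true then (1 : ZMod 2) else 0))) = 1)) ^^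
          (v (Fin.castLE hk (Fin.castAdd 3 (Fin.castAdd 3 (0 : Fin 1)))) &&
            decide ((∑ ii : Fin 3, ((if u (Fin.castLE hk (Fin.castAdd 3 (Fin.natAdd 1 ii))) = true then (1 : ZMod 2) else 0) * (if w (Fin.castLE hk (Fin.natAdd (1 + 3) ii)) = true then (1 : ZMod 2) else 0) +
              (if u (Fin.castLE hk (Fin.natAdd (1 + 3) ii)) = true then (1 : ZMod 2) else 0) * (if w (Fin.castLE hk (Fin.castAdd 3 (Fin.natAdd 1 ii))) = true then (1 : ZMod 2) else 0))) = 1))) ^^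
          (w (Fin.castLE hk (Fin.castAdd 3 (Fin.castAdd 3 (0 : Fin 1)))) &&
            decide ((∑ ii : Fin 3, ((if u (Fin.castLE hk (Fin.castAdd 3 (Fin.natAdd 1 ii))) = true then (1 : ZMod 2) else 0) * (if v (Fin.castLE hk (Fin.natAdd (1 + 3) ii)) = true then (1 : ZMod 2) else 0) +
              (if u (Fin.castLE hk (Fin.natAdd (1 + 3) ii)) = true then (1 : ZMod 2) else 0) * (if v (Fin.castLE hk (Fin.castAdd 3 (Fin.natAdd 1 ii))) = true then (1 : ZMod 2) else 0))) = 1))))) → i = false → j = false → False := by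
  intro hk _ κ hκ c d hcs hcc hcd hds hdc hdd hd hpair hD0 hF1 hsum i j hij hmin hpos hwt bz hsupp hT hi0 hj0
  subst hi0; subst hj0
  obtain ⟨lo, hi, hloi, hhii, hlohi, hlov, hhiv, hT8, t0, tlo, thi⟩ := tpw_R2_level_tables κ hκ d hd hD0 false false 3 hk hT
  -- weights
  have hW0 : #(univ.filter fun s : Fin 9 → Bool => κ (Fin.append ![false, false, false] s) = true) = 112 := by
    norm_num at hwt; omega
  have hTv : ∀ (vv : Fin 3 → Bool) (u v w x : Fin (1 + 8) → Bool),
      ((((κ (Fin.append vv x) ^^ κ (Fin.append vv (bxor x w))) ^^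
            (κ (Fin.append vv (bxor x v)) ^^ κ (Fin.append vv (bxor (bxor x v) w)))) ^^
          ((κ (Fin.append vv (bxor x u)) ^^ κ (Fin.append vv (bxor (bxor x u) w))) ^^
            (κ (Fin.append vv (bxor (bxor x u) v)) ^^
              κ (Fin.append vv (bxor (bxor (bxor x u) v) w)))))) =
      ((((u (Fin.castAdd 8 (0 : Fin 1)) &&
            decide ((∑ ii : Fin 3, ((if (fun jj => v (Fin.natAdd 1 jj)) (lo ii) = true then (1 : ZMod 2) else 0) * (if (fun jj => w (Fin.natAdd 1 jj)) (hi ii) = true then (1 : ZMod 2) else 0) +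
              (if (fun jj => v (Fin.natAdd 1 jj)) (hi ii) = true then (1 : ZMod 2) else 0) * (if (fun jj => w (Fin.natAdd 1 jj)) (lo ii) = true then (1 : ZMod 2) else 0))) = 1)) ^^
          (v (Fin.castAdd 8 (0 : Fin 1)) &&
            decide ((∑ ii : Fin 3, ((if (fun jj => u (Fin.natAdd 1 jj)) (lo ii) = true then (1 : ZMod 2) else 0) * (if (fun jj => w (Fin.natAdd 1 jj)) (hi ii) = true then (1 : ZMod 2) else 0) +
              (if (fun jj => u (Fin.natAdd 1 jj)) (hi ii) = true then (1 : ZMod 2) else 0) * (if (fun jj => w (Fin.natAdd 1 jj)) (lo ii) = true then (1 : ZMod 2) else 0))) = 1))) ^^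
          (w (Fin.castAdd 8 (0 : Fin 1)) &&
            decide ((∑ ii : Fin 3, ((if (fun jj => u (Fin.natAdd 1 jj)) (lo ii) = true then (1 : ZMod 2) else 0) * (if (fun jj => v (Fin.natAdd 1 jj)) (hi ii) = true then (1 : ZMod 2) else 0) +
              (if (fun jj => u (Fin.natAdd 1 jj)) (hi ii) = true then (1 : ZMod 2) else 0) * (if (fun jj => v (Fin.natAdd 1 jj)) (lo ii) = true then (1 : ZMod 2) else 0))) = 1)))) := by
    intro vv u v w x
    have e := tls_cells_third κ hκ vv ![false, false, false] u v w x x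
    dsimp only at e
    rw [e]
    exact hT8 u v w x
  have lb : ∀ vv : Fin 3 → Bool, 128 ≤ #(univ.filter fun s : Fin 9 → Bool => κ (Fin.append vv s) = true) + 2 ^ (7 - 3) := fun vv =>
    tl2_cell_eight_lb (fun s : Fin (1 + 8) → Bool => κ (Fin.append vv s)) 3 (by norm_num) (by norm_num) lo hi hloi hhii hlohi
      (fun a b : Fin 8 → Bool => decide ((∑ ii : Fin 3, ((if a (lo ii) = true then (1 : ZMod 2) else 0) * (if b (hi ii) = true then (1 : ZMod 2) else 0) +
        (if a (hi ii) = true then (1 : ZMod 2) else 0) * (if b (lo ii) = true then (1 : ZMod 2) else 0))) = 1)) (fun _ _ => rfl) (hTv vv)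
  have l1 := lb ![false, true, false]
  have l2 := lb ![false, false, true]
  norm_num at l1 l2
  have hw1 : #(univ.filter fun s : Fin 9 → Bool => κ (Fin.append ![false, true, false] s) = true) < 160 := by omega
  have hw2 : #(univ.filter fun s : Fin 9 → Bool => κ (Fin.append ![false, false, true] s) = true) < 160 := by omega
  have hb1 : bxor ![false, false, false] (fun l => decide (l = (1 : Fin 3))) = ![false, true, false] := by decide
  have hb2 : bxor ![false, false, false] (fun l => decide (l = (2 : Fin 3))) = ![false, false, true] := by decide
  have hw1' : #(univ.filter fun y : Fin (1 + 8) → Bool =>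
      κ (Fin.append (bxor ![false, false, false] (fun l => decide (l = (1 : Fin 3)))) y) = true) < 160 := by
    rw [hb1]; exact hw1
  have hw2' : #(univ.filter fun y : Fin (1 + 8) → Bool =>
      κ (Fin.append (bxor ![false, false, false] (fun l => decide (l = (2 : Fin 3)))) y) = true) < 160 := by
    rw [hb2]; exact hw2
  -- half space
  have i0 : (Fin.castLE hk (Fin.castAdd 3 (Fin.castAdd 3 (0 : Fin 1))) : Fin 9) = Fin.castAdd 8 (0 : Fin 1) := Fin.ext (by simp)
  have hhalf : ∀ s : Fin 8 → Bool, κ (Fin.append ![false, false, false] (Fin.append ![!bz] s)) = false := by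
    intro s
    cases hv : κ (Fin.append ![false, false, false] (Fin.append ![!bz] s)) with
    | false => rfl
    | true =>
      exfalso
      have e := hsupp (Fin.append ![!bz] s) hv
      rw [i0, Fin.append_left] at e
      revert e
      cases bz <;> decide
  obtain ⟨ε₁, hε₁⟩ := tls_light_structure κ hκ ![false, false, false] 3 le_rfl lo hi hloi hhii hlohi
    (fun a b : Fin 8 → Bool => decide ((∑ ii : Fin 3, ((if a (lo ii) = true then (1 : ZMod 2) else 0) * (if b (hi ii) = true then (1 : ZMod 2) else 0) +
        (if a (hi ii) = true then (1 : ZMod 2) else 0) * (if b (lo ii) = true then (1 : ZMod 2) else 0))) = 1)) (fun _ _ => rfl) hT8 bz hhalf 1 hw1'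
  obtain ⟨ε₂, hε₂⟩ := tls_light_structure κ hκ ![false, false, false] 3 le_rfl lo hi hloi hhii hlohi
    (fun a b : Fin 8 → Bool => decide ((∑ ii : Fin 3, ((if a (lo ii) = true then (1 : ZMod 2) else 0) * (if b (hi ii) = true then (1 : ZMod 2) else 0) +
        (if a (hi ii) = true then (1 : ZMod 2) else 0) * (if b (lo ii) = true then (1 : ZMod 2) else 0))) = 1)) (fun _ _ => rfl) hT8 bz hhalf 2 hw2'
  have hv0 : Fin.append ![false, false, false] (zeroVec : Fin (1 + 8) → Bool) = (zeroVec : Fin (3 + (1 + 8)) → Bool) := by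
    funext l
    refine Fin.addCases (fun t => ?_) (fun σ => ?_) l
    · rw [Fin.append_left]; fin_cases t <;> rfl
    · rw [Fin.append_right]; rfl
  have hGmix : ∀ σ τ : Fin 8, d (Fin.castAdd (1 + 8) 1) (Fin.natAdd 3 (Fin.natAdd 1 σ)) (Fin.natAdd 3 (Fin.natAdd 1 τ)) =
      if (ε₁ && (fun a b : Fin 8 → Bool => decide ((∑ ii : Fin 3, ((if a (lo ii) = true then (1 : ZMod 2) else 0) * (if b (hi ii) = true then (1 : ZMod 2) else 0) +
        (if a (hi ii) = true then (1 : ZMod 2) else 0) * (if b (lo ii) = true then (1 : ZMod 2) else 0))) = 1)) (fun l => decide (l = σ)) (fun l => decide (l = τ))) = true then 1 else 0 := by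
    intro σ τ
    have e := hε₁ σ τ
    rw [hv0] at e
    rw [hd]
    exact congrArg (fun b : Bool => if b = true then (1 : ZMod 2) else 0) e
  have hΓmix : ∀ σ τ : Fin 8, d (Fin.castAdd (1 + 8) 2) (Fin.natAdd 3 (Fin.natAdd 1 σ)) (Fin.natAdd 3 (Fin.natAdd 1 τ)) =
      if (ε₂ && (fun a b : Fin 8 → Bool => decide ((∑ ii : Fin 3, ((if a (lo ii) = true then (1 : ZMod 2) else 0) * (if b (hi ii) = true then (1 : ZMod 2) else 0) +
        (if a (hi ii) = true then (1 : ZMod 2) else 0) * (if b (lo ii) = true then (1 : ZMod 2) else 0))) = 1)) (fun l => decide (l = σ)) (fun l => decide (l = τ))) = true then 1 else 0 := by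
    intro σ τ
    have e := hε₂ σ τ
    rw [hv0] at e
    rw [hd]
    exact congrArg (fun b : Bool => if b = true then (1 : ZMod 2) else 0) e
  have hS : ∀ S : ZMod 2, (if decide (S = 1) = true then (1 : ZMod 2) else 0) = S := by decide
  have key2 : ∀ a b c e' : Bool, (a && c) = false →
      ((if (a = true ∧ b = true) ∨ (c = true ∧ e' = true) then (1 : ZMod 2) else 0) =
        (if a = true then (1 : ZMod 2) else 0) * (if b = true then 1 else 0) + (if c = true then 1 else 0) * (if e' = true then 1 else 0)) := by
    decide
  have hWω : ∀ σ τ : Fin 8, d (Fin.natAdd 3 (Fin.castAdd 8 (0 : Fin 1))) (Fin.natAdd 3 (Fin.natAdd 1 σ)) (Fin.natAdd 3 (Fin.natAdd 1 τ)) =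
      if (fun a b : Fin 8 → Bool => decide ((∑ ii : Fin 3, ((if a (lo ii) = true then (1 : ZMod 2) else 0) * (if b (hi ii) = true then (1 : ZMod 2) else 0) +
        (if a (hi ii) = true then (1 : ZMod 2) else 0) * (if b (lo ii) = true then (1 : ZMod 2) else 0))) = 1)) (fun l => decide (l = σ)) (fun l => decide (l = τ)) = true then 1 else 0 := by
    intro σ τ
    rw [t0]
    dsimp only
    rw [hS]
    refine Finset.sum_congr rfl fun q _ => ?_
    have hac : (decide (lo q = σ) && decide (hi q = σ)) = false := by
      by_cases h1 : lo q = σ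
      · have : ¬ hi q = σ := fun h2 => hlohi q q (h1.trans h2.symm)
        simp [this]
      · simp [h1]
    rw [← key2 _ _ _ _ hac]
    simp only [decide_eq_true_eq, Fin.natAdd_inj]
    have hiff : ((σ = lo q ∧ τ = hi q) ∨ (σ = hi q ∧ τ = lo q)) ↔ ((lo q = σ ∧ hi q = τ) ∨ (hi q = σ ∧ lo q = τ)) := by
      constructor
      · rintro (⟨h1, h2⟩ | ⟨h1, h2⟩)
        · exact Or.inl ⟨h1.symm, h2.symm⟩
        · exact Or.inr ⟨h1.symm, h2.symm⟩
      · rintro (⟨h1, h2⟩ | ⟨h1, h2⟩)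
        · exact Or.inl ⟨h1.symm, h2.symm⟩
        · exact Or.inr ⟨h1.symm, h2.symm⟩
    simp only [hiff]
  have hdiag : ∀ φ k, d φ φ k = 0 := fun φ k => (hds φ k φ).trans ((hdc k φ φ).trans (hdd k φ))
  have hsplit : ∀ s : Fin (1 + 8), s ≠ Fin.castAdd 8 (0 : Fin 1) → ∃ σ : Fin 8, s = Fin.natAdd 1 σ := by
    intro s hs
    have h0 : s.val ≠ 0 := fun h0 => hs (Fin.ext (by simpa using h0))
    exact ⟨⟨s.val - 1, by omega⟩, Fin.ext (by simp; omega)⟩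
  have hrows : ∀ (t : Fin 3) (εb : Bool),
      (∀ σ τ : Fin 8, d (Fin.castAdd (1 + 8) t) (Fin.natAdd 3 (Fin.natAdd 1 σ)) (Fin.natAdd 3 (Fin.natAdd 1 τ)) =
        if (εb && (fun a b : Fin 8 → Bool => decide ((∑ ii : Fin 3, ((if a (lo ii) = true then (1 : ZMod 2) else 0) * (if b (hi ii) = true then (1 : ZMod 2) else 0) +
        (if a (hi ii) = true then (1 : ZMod 2) else 0) * (if b (lo ii) = true then (1 : ZMod 2) else 0))) = 1)) (fun l => decide (l = σ)) (fun l => decide (l = τ))) = true then 1 else 0) →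
      ∀ s u : Fin (1 + 8), d (Fin.castAdd (1 + 8) t) (Fin.natAdd 3 s) (Fin.natAdd 3 u) =
        (if εb = true then (1 : ZMod 2) else 0) * d (Fin.natAdd 3 (Fin.castAdd 8 (0 : Fin 1))) (Fin.natAdd 3 s) (Fin.natAdd 3 u) +
        (if s = Fin.castAdd 8 (0 : Fin 1) then d (Fin.castAdd (1 + 8) t) (Fin.natAdd 3 (Fin.castAdd 8 (0 : Fin 1))) (Fin.natAdd 3 u) else 0) +
        (if u = Fin.castAdd 8 (0 : Fin 1) then d (Fin.castAdd (1 + 8) t) (Fin.natAdd 3 (Fin.castAdd 8 (0 : Fin 1))) (Fin.natAdd 3 s) else 0) := by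
    intro t εb hmix
    refine tlg_light_rows (fun s u => d (Fin.castAdd (1 + 8) t) (Fin.natAdd 3 s) (Fin.natAdd 3 u))
      (fun s u => d (Fin.natAdd 3 (Fin.castAdd 8 (0 : Fin 1))) (Fin.natAdd 3 s) (Fin.natAdd 3 u)) (Fin.castAdd 8 (0 : Fin 1))
      (if εb = true then (1 : ZMod 2) else 0) (fun s u => hds _ _ _) (hdd _ _) (fun u => hdiag _ _) (fun s => ?_) (fun s u hs hu => ?_)
    · show d _ _ _ = 0
      rw [hds]; exact hdiag _ _
    · obtain ⟨σ, rfl⟩ := hsplit s hs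
      obtain ⟨τ, rfl⟩ := hsplit u hu
      show d _ _ _ = _ * d _ _ _
      rw [hmix, hWω, tlg_ite_and]
  have hG := hrows 1 ε₁ hGmix
  have hΓ := hrows 2 ε₂ hΓmix
  -- the leaf's coordinates on `Fin (1 + 6 + 2)`: `z0`, the six `ω`-coordinates `1..6`, and `F′ = {7, 8}`
  have hz0 : (Fin.castAdd 2 (Fin.castAdd 6 (0 : Fin 1)) : Fin 9) = Fin.castAdd 8 (0 : Fin 1) := Fin.ext (by simp)
  have hPlo : ∀ q : Fin 3, (Fin.castAdd 2 (Fin.natAdd 1 (⟨q.val, by omega⟩ : Fin 6)) : Fin 9) = Fin.natAdd 1 (lo q) := fun q =>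
    Fin.ext (by simp [hlov])
  have hPhi : ∀ q : Fin 3, (Fin.castAdd 2 (Fin.natAdd 1 (⟨3 + q.val, by omega⟩ : Fin 6)) : Fin 9) = Fin.natAdd 1 (hi q) := fun q =>
    Fin.ext (by simp [hhiv])
  -- the slice of `t̄` at an `F′`-coordinate vanishes
  have hFne : ∀ (f : Fin 2), (Fin.natAdd (1 + 6) f : Fin 9) ≠ Fin.castAdd 8 (0 : Fin 1) ∧
      (∀ q, (Fin.natAdd (1 + 6) f : Fin 9) ≠ Fin.natAdd 1 (lo q)) ∧ (∀ q, (Fin.natAdd (1 + 6) f : Fin 9) ≠ Fin.natAdd 1 (hi q)) := by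
    intro f
    refine ⟨fun h => ?_, fun q h => ?_, fun q h => ?_⟩
    · have := congrArg Fin.val h; simp at this
    · have := congrArg Fin.val h; simp [hlov] at this; omega
    · have := congrArg Fin.val h; simp [hhiv] at this; omega
  have hFrow : ∀ (f : Fin 2) (c' : Fin 9),
      d (Fin.natAdd 3 (Fin.natAdd (1 + 6) f)) (Fin.natAdd 3 (Fin.castAdd 8 (0 : Fin 1))) (Fin.natAdd 3 c') = 0 ∧
      (∀ q, d (Fin.natAdd 3 (Fin.natAdd (1 + 6) f)) (Fin.natAdd 3 (Fin.natAdd 1 (lo q))) (Fin.natAdd 3 c') = 0) ∧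
      (∀ q, d (Fin.natAdd 3 (Fin.natAdd (1 + 6) f)) (Fin.natAdd 3 (Fin.natAdd 1 (hi q))) (Fin.natAdd 3 c') = 0) := by
    intro f c'
    obtain ⟨hf0, hflo, hfhi⟩ := hFne f
    refine ⟨?_, fun q => ?_, fun q => ?_⟩
    · rw [hdc, t0]
      refine Finset.sum_eq_zero fun q _ => if_neg ?_
      rintro (⟨h, -⟩ | ⟨h, -⟩)
      · exact hflo q h
      · exact hfhi q h
    · rw [hdc, tlo, if_neg]
      rintro (⟨h, -⟩ | ⟨h, -⟩)
      · exact hf0 h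
      · exact hfhi q h
    · rw [hdc, thi, if_neg]
      rintro (⟨h, -⟩ | ⟨h, -⟩)
      · exact hf0 h
      · exact hflo q h
  have hcover3 : ∀ x : Fin 9, x = Fin.castAdd 8 (0 : Fin 1) ∨ (∃ q, x = Fin.natAdd 1 (lo q) ∨ x = Fin.natAdd 1 (hi q)) ∨
      ∃ f : Fin 2, x = Fin.natAdd (1 + 6) f := by
    intro x
    have hx := x.isLt
    rcases Nat.lt_or_ge x.val 1 with h0 | h1
    · left; exact Fin.ext (by simp; omega)
    · right
      rcases Nat.lt_or_ge x.val 4 with h4 | h4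
      · left; refine ⟨⟨x.val - 1, by omega⟩, Or.inl (Fin.ext ?_)⟩
        simp only [Fin.val_natAdd, hlov]; omega
      · rcases Nat.lt_or_ge x.val 7 with h7 | h7
        · left; refine ⟨⟨x.val - 4, by omega⟩, Or.inr (Fin.ext ?_)⟩
          simp only [Fin.val_natAdd, hhiv]; omega
        · right; refine ⟨⟨x.val - 7, by omega⟩, Fin.ext ?_⟩
          simp only [Fin.val_natAdd]; omega
  have htbF : ∀ (f : Fin 2) (s t : Fin (1 + 6 + 2)),
      d (Fin.natAdd 3 (Fin.natAdd (1 + 6) f)) (Fin.natAdd 3 s) (Fin.natAdd 3 t) = 0 := by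
    intro f s t
    rcases hcover3 s with rfl | ⟨q, rfl | rfl⟩ | ⟨f', rfl⟩
    · exact (hFrow f t).1
    · exact (hFrow f t).2.1 q
    · exact (hFrow f t).2.2 q
    · rw [hds]
      rcases hcover3 t with rfl | ⟨q, rfl | rfl⟩ | ⟨f'', rfl⟩
      · exact (hFrow f _).1
      · exact (hFrow f _).2.1 q
      · exact (hFrow f _).2.2 q
      · -- three `F′`-indices among two: two coincide
        by_cases e1 : f = f''
        · subst e1; exact hdiag _ _
        · by_cases e2 : f'' = f'
          · subst e2; exact hdd _ _
          · have e3 : f = f' := by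
              have := f.isLt; have := f'.isLt; have := f''.isLt
              apply Fin.ext
              have h1 : f.val ≠ f''.val := fun h => e1 (Fin.ext h)
              have h2 : f''.val ≠ f'.val := fun h => e2 (Fin.ext h)
              omega
            subst e3; rw [hds]; exact hdiag _ _
  have htbP : ∀ t : Fin 6, ∃ f : Fin 6, ∀ s u : Fin (1 + 6 + 2),
      d (Fin.natAdd 3 (Fin.castAdd 2 (Fin.natAdd 1 f))) (Fin.natAdd 3 s) (Fin.natAdd 3 u) =
        if (s = Fin.castAdd 2 (Fin.castAdd 6 0) ∧ u = Fin.castAdd 2 (Fin.natAdd 1 t)) ∨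
           (u = Fin.castAdd 2 (Fin.castAdd 6 0) ∧ s = Fin.castAdd 2 (Fin.natAdd 1 t)) then 1 else 0 := by
    intro t
    rcases Nat.lt_or_ge t.val 3 with ht | ht
    · -- `t` is the `lo` coordinate `q`; its partner is `hi q`
      have htq : t = ⟨(⟨t.val, ht⟩ : Fin 3).val, by omega⟩ := Fin.ext rfl
      refine ⟨⟨3 + t.val, by omega⟩, fun s u => ?_⟩
      have e1 := hPhi ⟨t.val, ht⟩
      have e2 := hPlo ⟨t.val, ht⟩
      simp only at e1 e2
      rw [← htq] at e2
      rw [e1, hz0, e2, thi]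
      congr 1
      refine propext ⟨?_, ?_⟩
      · rintro (⟨h1, h2⟩ | ⟨h1, h2⟩)
        · exact Or.inl ⟨h1, h2⟩
        · exact Or.inr ⟨h2, h1⟩
      · rintro (⟨h1, h2⟩ | ⟨h1, h2⟩)
        · exact Or.inl ⟨h1, h2⟩
        · exact Or.inr ⟨h2, h1⟩
    · -- `t` is the `hi` coordinate `q`; its partner is `lo q`
      have htq : t = ⟨3 + (⟨t.val - 3, by omega⟩ : Fin 3).val, by simp; omega⟩ := Fin.ext (by simp; omega)
      refine ⟨⟨t.val - 3, by omega⟩, fun s u => ?_⟩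
      have e1 := hPlo ⟨t.val - 3, by omega⟩
      have e2 := hPhi ⟨t.val - 3, by omega⟩
      simp only at e1 e2
      rw [← htq] at e2
      rw [e1, hz0, e2, tlo]
      congr 1
      refine propext ⟨?_, ?_⟩
      · rintro (⟨h1, h2⟩ | ⟨h1, h2⟩)
        · exact Or.inl ⟨h1, h2⟩
        · exact Or.inr ⟨h2, h1⟩
      · rintro (⟨h1, h2⟩ | ⟨h1, h2⟩)
        · exact Or.inl ⟨h1, h2⟩
        · exact Or.inr ⟨h2, h1⟩
  have hG' : ∀ s t : Fin (1 + 6 + 2), d (Fin.castAdd 9 1) (Fin.natAdd 3 s) (Fin.natAdd 3 t) =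
      (if ε₁ = true then (1 : ZMod 2) else 0) * d (Fin.natAdd 3 (Fin.castAdd 2 (Fin.castAdd 6 0))) (Fin.natAdd 3 s) (Fin.natAdd 3 t) +
        (if s = Fin.castAdd 2 (Fin.castAdd 6 0) then d (Fin.castAdd (1 + 8) 1) (Fin.natAdd 3 (Fin.castAdd 8 (0 : Fin 1))) (Fin.natAdd 3 t) else 0) +
        (if t = Fin.castAdd 2 (Fin.castAdd 6 0) then d (Fin.castAdd (1 + 8) 1) (Fin.natAdd 3 (Fin.castAdd 8 (0 : Fin 1))) (Fin.natAdd 3 s) else 0) := by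
    intro s t; rw [hz0]; exact hG s t
  have hΓ' : ∀ s t : Fin (1 + 6 + 2), d (Fin.castAdd 9 2) (Fin.natAdd 3 s) (Fin.natAdd 3 t) =
      (if ε₂ = true then (1 : ZMod 2) else 0) * d (Fin.natAdd 3 (Fin.castAdd 2 (Fin.castAdd 6 0))) (Fin.natAdd 3 s) (Fin.natAdd 3 t) +
        (if s = Fin.castAdd 2 (Fin.castAdd 6 0) then d (Fin.castAdd (1 + 8) 2) (Fin.natAdd 3 (Fin.castAdd 8 (0 : Fin 1))) (Fin.natAdd 3 t) else 0) +
        (if t = Fin.castAdd 2 (Fin.castAdd 6 0) then d (Fin.castAdd (1 + 8) 2) (Fin.natAdd 3 (Fin.castAdd 8 (0 : Fin 1))) (Fin.natAdd 3 s) else 0) := by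
    intro s t; rw [hz0]; exact hΓ s t
  exact tpa_R2_w6 c d hcs hcc hcd hds hdc hdd hpair hF1 htbF htbP (if ε₁ = true then (1 : ZMod 2) else 0)
    (if ε₂ = true then (1 : ZMod 2) else 0)
    (fun u => d (Fin.castAdd (1 + 8) 1) (Fin.natAdd 3 (Fin.castAdd 8 (0 : Fin 1))) (Fin.natAdd 3 u))
    (fun u => d (Fin.castAdd (1 + 8) 2) (Fin.natAdd 3 (Fin.castAdd 8 (0 : Fin 1))) (Fin.natAdd 3 u)) hG' hΓ'

end Summit.QuantumAdvantage.QuantumAdvantage.Theorems.CubicForrelation.NearExactIsExact
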